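import Summits.ABC.ABC.Theorems.IsogenyGlueCongruenceMazurKenkuBoundStubRangeOfPlace
import Summits.ABC.ABC.Theorems.IsogenyGlueCongruenceMazurKenkuBoundStubRangeOfTwist

/-!
# Route `IsogenyGlueCongruence`, crux `MazurKenkuBound` (stmt-ABC-15125) — line `Sketch`:
# stub `stub_range_of` (Mazur 1978, Prop. 5.1: Raynaud's range by tame characters)

Helper (`--supports stmt-ABC-15125`) of the line lead's skeleton
`Cruxes/MazurKenkuBound/Lines/Sketch.lean`: the registered stub `stub_range_of`. For an elliptic
curve `E/ℚ` with a rational `N`-isogeny (`N = 11` or `N ≥ 17`), stable line `⟨P⟩` with character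
`r`, `j(E)` integral at `N` and `r = χ̄ᵏ⁰` on the inertia groups at `N`, there are
`e ∈ {1,2,3,4,6}` and `0 ≤ j ≤ e` with `e k₀ ≡ j (mod N - 1)` — B. Mazur, *Rational isogenies of
prime degree*, Invent. Math. 44 (1978), proof of Prop. 5.1 (p. 150), display
`0 ≤ (e₀k)_m ≤ e₀`, there from Raynaud's theorem over the good-reduction field of ramification
`e = 2e₀`; here from four elementary inputs (the other registered stubs, taken as hypotheses) and
the helpers of `…StubRangeOfPlace`, `…StubRangeOfTwist` (place above `N`, twisted good model,
congruences). References: [Mazur1978] §5, proof of Prop. 5.1 (pp. 150–151); [Serre1972]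
J.-P. Serre, Invent. Math. 15 (1972), §1 Prop. 8; [SilvermanAEC2009] III.1, IV.1, VII.2, VII.5.
-/


-- `Summit.<Summit>.<Problem>` is the mandated summit-side namespace (CONVENTIONS §2); for the
-- single-conjunct summit `ABC` the two coincide, so the duplicate `ABC.ABC` is deliberate.
set_option linter.dupNamespace false

noncomputable section

open scoped NNReal NumberField Classical

open WeierstrassCurve IsDedekindDomain Field NumberField
open Literature.NumberTheory.EllipticCurves
open Literature.NumberTheory.GaloisRepresentations

-- The `ℚ`-algebra diamond on `AlgebraicClosure ℚ` (`DivisionRing.toRatAlgebra` vs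
-- `AlgebraicClosure.instAlgebra`, defeq but not at instance transparency): the Galois-module
-- structures of the tree are keyed on the latter (same device as `GeomPointReduction`).
attribute [-instance] DivisionRing.toRatAlgebra

namespace Summit.ABC.ABC.Theorems

/-! ### The range theorem -/

set_option maxHeartbeats 400000 in
/-- **Raynaud's range by tame characters** (the registered stub `stub_range_of` of line
`Sketch`). For `E/ℚ` with a rational `N`-isogeny (`N = 11` or `N ≥ 17`), stable line `⟨P⟩` with
character `r`, `j(E)` integral at `N`, and `k₀` with `r = χ̄ᵏ⁰` on the inertia groups at `N`:
there are `e ∈ {1,2,3,4,6}` and `0 ≤ j ≤ e` with `e k₀ ≡ j (mod N - 1)` — Mazur's display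
`0 ≤ (e₀k)_m ≤ e₀` (1978, p. 150). Inputs (hypotheses, each a landed stub of the line):
linearity of `z` along multiples in the kernel of reduction (`hB`), the crude bound
`|N| ≤ |z|^{N-1}` for `N`-torsion in the kernel (`hC`), rationality of the product of `z` over the
line (`hE`), the cyclotomic uniformiser (`hF`). Proof: twist a short model by `u = ρ^{n'}`,
`ρ = ρ'^{N-1}`, `ρ'^{e(N-1)} = N`, to an explicit good model over the valuation ring of a place
of `ℚ̄` above `N`; take the Kummer element `τ ∈ I_𝔓` of a primitive `(N-1)`-th root of unity
`ζ` (`τρ' = ζρ'`); if the line misses the kernel of reduction, `r(τ) = 1` and `j = 0`; otherwise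
`|z(P)| = |ρ'|ʲ`, `1 ≤ j ≤ e`, `ζʲ ≡ r(τ) ≡ χ̄(τ)^{k₀} ≡ ζ^{e k₀}`, and roots of unity of order
`N - 1` are distinct modulo `𝔓`. [cite: Mazur1978, proof of Prop. 5.1 (p. 150)] [cite: Serre1972, §1 Prop. 8] -/
theorem stub_range_of
    (hB : ∀ {F : Type} [Field F] {w : Valuation F ℝ≥0} {V : WeierstrassCurve F}
      [V.IsIntegral w.integer] {P : V.toAffine.Point}, P ∈ FormalGroupChart.kernel w V →
      ∀ {a : ℕ}, 1 ≤ a → (∀ b : ℕ, 1 ≤ b → b ≤ a → w (b : F) = 1) →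
      a • P ∈ FormalGroupChart.kernel w V ∧ w (a • P).zCoord = w P.zCoord ∧
        w ((a • P).zCoord - (a : F) * P.zCoord) ≤ w P.zCoord ^ 2)
    (hC : ∀ {F : Type} [Field F] {w : Valuation F ℝ≥0} {V : WeierstrassCurve F}
      [V.IsIntegral w.integer] (N : ℕ) [Fact N.Prime], N ≠ 2 → (N : F) ≠ 0 →
      ∀ {x y : F} {h : V.toAffine.Nonsingular x y}, 1 < w x →
      (N : ℤ) • (Affine.Point.some x y h : V.toAffine.Point) = 0 → w (N : F) ≤ w (-x / y) ^ (N - 1))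
    (hE : ∀ (W : WeierstrassCurve ℚ) [W.IsElliptic] (N : ℕ) [Fact N.Prime] {P : geomTorsion W N},
      P ≠ 0 → ∀ {r : absoluteGaloisGroup ℚ →* (ZMod N)ˣ},
      (∀ σ : absoluteGaloisGroup ℚ, σ • P = ((r σ : (ZMod N)ˣ) : ZMod N).val • P) →
      ∃ q : ℚ, (∏ a ∈ Finset.Ico 1 N,
        Affine.Point.zCoord (a • ((P : geomPoints W) : (W.baseChange (AlgebraicClosure ℚ)).toAffine.Point))) =
          (q : AlgebraicClosure ℚ))
    (hF : ∀ (N : ℕ) [Fact N.Prime] {ζ : AlgebraicClosure ℚ}, IsPrimitiveRoot ζ N →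
      (∃ ε : AlgebraicClosure ℚ, IsIntegral ℤ ε ∧ IsIntegral ℤ ε⁻¹ ∧
          (ζ - 1) ^ (N - 1) = (N : AlgebraicClosure ℚ) * ε) ∧
        ∀ σ : absoluteGaloisGroup ℚ, ∃ m : AlgebraicClosure ℚ, IsIntegral ℤ m ∧
          σ • (ζ - 1) = (ζ - 1) *
            ((((modNCyclotomicCharacter ℚ N σ : (ZMod N)ˣ) : ZMod N).val : AlgebraicClosure ℚ) +
              (ζ - 1) * m)) :
    ∀ (W : WeierstrassCurve ℚ) [W.IsElliptic] (N : ℕ) [Fact N.Prime], (N = 11 ∨ 17 ≤ N) →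
    ∀ {P : geomTorsion W N}, P ≠ 0 → ∀ {r : absoluteGaloisGroup ℚ →* (ZMod N)ˣ},
    (∀ σ : absoluteGaloisGroup ℚ, σ • P = ((r σ : (ZMod N)ˣ) : ZMod N).val • P) →
    (∀ v : HeightOneSpectrum (𝓞 ℚ), (N : 𝓞 ℚ) ∈ v.asIdeal → v.valuation ℚ W.j ≤ 1) →
    ∀ k₀ : ℕ,
    (∀ (v : HeightOneSpectrum (𝓞 ℚ)), (N : 𝓞 ℚ) ∈ v.asIdeal → ∀ 𝔓 ∈ v.primesAbove,
      ∀ τ ∈ 𝔓.inertia (absoluteGaloisGroup ℚ), r τ = modNCyclotomicCharacter ℚ N τ ^ k₀) →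
    ∃ e ∈ ({1, 2, 3, 4, 6} : Finset ℕ), ∃ j ≤ e, e * k₀ ≡ j [MOD N - 1] := by
  intro W _ N _ hN11 P hP0 r hr hj k₀ hk₀I
  have hN : N.Prime := Fact.out
  have h5 : 5 ≤ N := by omega
  have hN2 : N ≠ 2 := by omega
  have hN1 : 0 < N - 1 := by omega
  set L := AlgebraicClosure ℚ with hLdef
  have hNL : (N : L) ≠ 0 := by exact_mod_cast hN.ne_zero
  -- (1) the place above `N`
  obtain ⟨v, 𝔓, w, hvN, h𝔓, hiso, hinert, hNlt, hint, hintg, hratv, hkum⟩ := exists_placeData N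
  have hv0 : w.Integers w.integer := Valuation.integer.integers w
  set t : ℝ≥0 := w (N : L) with htdef
  have ht0 : 0 < t := zero_lt_iff.mpr ((Valuation.ne_zero_iff w).mpr hNL)
  have hwb : ∀ b : ℕ, 1 ≤ b → b < N → w (b : L) = 1 := fun b hb1 hbN ↦ by
    have h := hint b (by
      intro hd
      have := Int.le_of_dvd (by exact_mod_cast hb1) hd
      omega)
    rwa [Int.cast_natCast] at h
  have hwM : w ((N - 1 : ℕ) : L) = 1 := hwb (N - 1) hN1 (Nat.sub_lt hN.pos one_pos)
  -- (2) the short model `X` and the twist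
  letI : Invertible (2 : ℚ) := invertibleOfNonzero two_ne_zero
  letI : Invertible (3 : ℚ) := invertibleOfNonzero three_ne_zero
  set C₀ : VariableChange ℚ := W.toShortNF with hC₀
  set X : WeierstrassCurve ℚ := C₀ • W with hXdef
  haveI hXsh : X.IsShortNF := W.toShortNF_spec
  have hjX : w (X.j : L) ≤ 1 := by
    have hjj : X.j = W.j := variableChange_j W C₀
    rw [hjj]; exact hratv _ (hj v hvN)
  obtain ⟨e, he, n', ρ', hρ'0, hρ', ha4, ha6, hΔ⟩ := exists_goodTwist w hN h5 hNlt hint X hjX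
  have he0 : 0 < e := by
    simp only [Finset.mem_insert, Finset.mem_singleton] at he
    rcases he with rfl | rfl | rfl | rfl | rfl <;> norm_num
  set u : L := (ρ' ^ (N - 1)) ^ n' with hudef
  have hu0 : u ≠ 0 := zpow_ne_zero _ (pow_ne_zero _ hρ'0)
  have hwu0 : w u ≠ 0 := (Valuation.ne_zero_iff w).mpr hu0
  set g : ℝ≥0 := w ρ' with hgdef
  have hg0' : g ≠ 0 := (Valuation.ne_zero_iff w).mpr hρ'0
  have hg0 : 0 < g := zero_lt_iff.mpr hg0'
  have hgt : g ^ (e * (N - 1)) = t := by rw [hgdef, ← map_pow, hρ']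
  have hg1 : g < 1 := by
    by_contra hge
    rw [not_lt] at hge
    have : 1 ≤ g ^ (e * (N - 1)) := one_le_pow₀ hge
    rw [hgt] at this
    exact absurd hNlt (not_lt.mpr this)
  have hganti := zpow_right_strictAnti₀ hg0 hg1
  have hwu : w u = (g ^ (N - 1)) ^ n' := by rw [hudef, map_zpow₀, map_pow]
  -- (3) the integral model `W₀` over the valuation ring, `(u; 0, 0, 0) • X_L = W₀ ⊗ L`
  obtain ⟨W₀, hW₀, hΔ0⟩ := exists_integralTwistModel w X hu0 ha4 ha6 hΔ
  set uU : Lˣ := Units.mk0 u hu0 with huU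
  set CL : VariableChange L := ⟨uU, 0, 0, 0⟩ with hCL
  haveI : (W₀.baseChange L).IsIntegral w.integer := ⟨W₀, rfl⟩
  -- (4) the points `Ps` (short model), `Q = Φ Ps` (good model)
  set P' : (W.baseChange L).toAffine.Point := (P : geomPoints W) with hP'def
  have hP'smul : ∀ σ : absoluteGaloisGroup ℚ,
      Affine.Point.map ((absoluteGaloisGroup.toAlgEquiv ℚ σ : L ≃ₐ[ℚ] L) : L →ₐ[ℚ] L) P' =
        ((r σ : (ZMod N)ˣ) : ZMod N).val • P' := by
    intro σ
    have h1 := congrArg Subtype.val (hr σ)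
    exact h1
  have hP'0 : P' ≠ 0 := fun h ↦ hP0 (Subtype.ext h)
  have hP'N : (N : ℕ) • P' = 0 := by
    have h := (Submodule.mem_torsionBy_iff _ _).mp P.2
    rw [← natCast_zsmul]; exact h
  set Ps : ((C₀ • W).baseChange L).toAffine.Point := VariableChange.pointEquivBaseChange W C₀ L P'
    with hPsdef
  have hPs_smul : ∀ σ : absoluteGaloisGroup ℚ,
      Affine.Point.map ((absoluteGaloisGroup.toAlgEquiv ℚ σ : L ≃ₐ[ℚ] L) : L →ₐ[ℚ] L) Ps =
        ((r σ : (ZMod N)ˣ) : ZMod N).val • Ps := by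
    intro σ
    rw [hPsdef, ← VariableChange.pointEquivBaseChange_map_algEquiv, hP'smul, map_nsmul]
  have hPs0 : Ps ≠ 0 := fun h ↦ hP'0 ((VariableChange.pointEquivBaseChange W C₀ L).injective
    (h.trans (VariableChange.pointEquivBaseChange_zero W C₀ L).symm))
  have hPsN : (N : ℕ) • Ps = 0 := by rw [hPsdef, ← map_nsmul, hP'N, map_zero]
  have hPs_mem : (Ps : geomPoints X) ∈ geomTorsion X N := (Submodule.mem_torsionBy_iff _ _).mpr (by
    change (N : ℤ) • Ps = 0
    rw [natCast_zsmul]; exact hPsN)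
  set Pt : geomTorsion X N := ⟨Ps, hPs_mem⟩ with hPtdef
  have hPt0 : Pt ≠ 0 := fun h ↦ hPs0 (congrArg Subtype.val h)
  have hrt : ∀ σ : absoluteGaloisGroup ℚ, σ • Pt = ((r σ : (ZMod N)ˣ) : ZMod N).val • Pt :=
    fun σ ↦ Subtype.ext (hPs_smul σ)
  -- the good-model point map `Φ`
  set Φ : (X.baseChange L).toAffine.Point →+ (W₀.baseChange L).toAffine.Point :=
    (Affine.Point.congrEquiv hW₀).toAddMonoidHom.comp
      (VariableChange.pointEquiv (X.baseChange L) CL).toAddMonoidHom with hΦdef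
  have hΦapply : ∀ R, Φ R = Affine.Point.congrEquiv hW₀ (VariableChange.pointEquiv _ CL R) :=
    fun R ↦ rfl
  have hΦz : ∀ R : (X.baseChange L).toAffine.Point, (Φ R).zCoord = u * R.zCoord := fun R ↦ by
    rw [hΦapply, zCoord_congrEquiv, hCL, zCoord_pointEquiv_diag, huU, Units.val_mk0]
  have hΦinj : Function.Injective Φ := fun R₁ R₂ h ↦
    (VariableChange.pointEquiv _ CL).injective ((Affine.Point.congrEquiv hW₀).injective h)
  set Q : (W₀.baseChange L).toAffine.Point := Φ Ps with hQdef
  have hQ0 : Q ≠ 0 := fun h ↦ hPs0 (hΦinj (h.trans (map_zero Φ).symm))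
  have hQN : (N : ℕ) • Q = 0 := by rw [hQdef, ← map_nsmul, hPsN, map_zero]
  have hQmul : ∀ m : ℕ, m • Q = Φ (m • Ps) := fun m ↦ by rw [hQdef, map_nsmul]
  -- (5) the primitive `(N-1)`-th root of unity and its Kummer element `τ ∈ I_𝔓`
  haveI : NeZero ((N - 1 : ℕ) : L) := ⟨by exact_mod_cast hN1.ne'⟩
  obtain ⟨ζ₀, hζ₀⟩ := HasEnoughRootsOfUnity.exists_primitiveRoot L (N - 1)
  have hζ₀1 : ζ₀ ^ (N - 1) = 1 := hζ₀.pow_eq_one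
  have hζ₀0 : ζ₀ ≠ 0 := hζ₀.ne_zero hN1.ne'
  have hwζ₀ : w ζ₀ = 1 := by
    have h : w ζ₀ ^ (N - 1) = 1 := by rw [← map_pow, hζ₀1, map_one]
    exact (pow_eq_one_iff_of_nonneg zero_le hN1.ne').mp h
  obtain ⟨τ, hτI, hτρ⟩ := hkum (Nat.mul_pos he0 hN1) hρ'
    (show ζ₀ ^ (e * (N - 1)) = 1 by rw [mul_comm, pow_mul, hζ₀1, one_pow])
  set σ' : L ≃ₐ[ℚ] L := absoluteGaloisGroup.toAlgEquiv ℚ τ with hσ'def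
  have hτsmul : ∀ z : L, τ • z = σ' z := fun z ↦ rfl
  have hτρN : τ • (ρ' ^ (N - 1)) = ρ' ^ (N - 1) := by
    rw [smul_pow', hτρ, mul_pow, hζ₀1, one_mul]
  have hτu : τ • u = u := by
    rw [hτsmul, hudef, map_zpow₀, ← hτsmul, hτρN]
  have hCfix : CL.map (σ' : L →+* L) = CL := by
    rw [hCL]
    ext
    · change σ' (uU : L) = uU
      rw [huU, Units.val_mk0, ← hτsmul, hτu]
    · exact map_zero _
    · exact map_zero _
    · exact map_zero _
  -- the scalar `a = r(τ)` and the cyclotomic scalar `c = χ̄(τ)`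
  set a : ℕ := ((r τ : (ZMod N)ˣ) : ZMod N).val with hadef
  set c : ℕ := ((modNCyclotomicCharacter ℚ N τ : (ZMod N)ˣ) : ZMod N).val with hcdef
  haveI : Fact (1 < N) := ⟨hN.one_lt⟩
  have haN : a < N := ZMod.val_lt _
  have ha1 : 1 ≤ a := by
    rw [Nat.one_le_iff_ne_zero, hadef, ne_eq, ZMod.val_eq_zero]
    exact (r τ).ne_zero
  have hτPs : Affine.Point.map (σ' : L →ₐ[ℚ] L) Ps = a • Ps := hPs_smul τ
  have hred : goodReductionHom W₀ hv0 hΔ0 (a • Q) = goodReductionHom W₀ hv0 hΔ0 Q := by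
    rw [hQmul, hQdef, hΦapply, hΦapply]
    exact goodReductionHom_nsmul_eq w X CL hW₀ hΔ0 σ' (fun z ↦ hiso τ hτI z)
      (fun z hz ↦ hinert τ hτI z hz) hCfix hτPs
  -- `r τ = χ̄ τ ^ k₀`: `a ≡ c ^ k₀ (mod N)`
  have hac : w ((a : L) - (c : L) ^ k₀) < 1 := by
    refine val_natCast_sub_pow_lt_one w hNlt hintg ?_
    rw [hadef, hcdef, ZMod.natCast_zmod_val, ZMod.natCast_zmod_val, ← Units.val_pow_eq_pow_val,
      ← hk₀I v hvN 𝔓 h𝔓 τ hτI]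
  -- the cyclotomic uniformiser: `ζ₀ᵉ ≡ c`
  haveI : NeZero ((N : ℕ) : ℚ) := ⟨by exact_mod_cast hN.ne_zero⟩
  haveI : NeZero ((N : ℕ) : L) := ⟨hNL⟩
  obtain ⟨ζN, hζN⟩ := HasEnoughRootsOfUnity.exists_primitiveRoot L N
  obtain ⟨⟨ε, hεi, hεi', hε⟩, hF2⟩ := hF N hζN
  obtain ⟨m₁, hm₁i, hm₁⟩ := hF2 τ
  have hwζe1 : w (ζ₀ ^ e) = 1 := by rw [map_pow, hwζ₀, one_pow]
  have hζec : w (ζ₀ ^ e - (c : L)) < 1 :=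
    val_sub_natCast_lt_one_of_uniformisers w hN hN1 hNlt hintg (fun z hz ↦ hinert τ hτI z hz) hζN
      hεi hεi' hε (ρ₁ := ρ' ^ e) (by rw [← pow_mul, hρ']) hwζe1
      (by rw [smul_pow', hτρ, mul_pow]) hm₁i hm₁
  have hwc : w (c : L) ≤ 1 := val_natCast_le_one w c
  have hwζe : w (ζ₀ ^ e) ≤ 1 := by rw [map_pow, hwζ₀, one_pow]
  have hζeck : w ((ζ₀ ^ e) ^ k₀ - (c : L) ^ k₀) < 1 := val_pow_sub_pow_lt_one w hwζe hwc hζec k₀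
  -- (6) the dichotomy: does `Q` lie in the kernel of reduction?
  by_cases hker : Q ∈ FormalGroupChart.kernel w (W₀.baseChange L)
  · -- KERNEL CASE: the line lies in the kernel of reduction; `|z| = |ρ'|ᴶ`, `1 ≤ J ≤ e`,
    -- `ζ₀ᴶ ≡ r(τ) ≡ χ̄(τ)^{k₀} ≡ ζ₀^{e k₀}`
    rcases hQc : Q with _ | ⟨xQ, yQ, hQxy⟩
    · exact absurd hQc hQ0
    have hxQ : 1 < w xQ := hker hQc
    set zQ : L := Q.zCoord with hzQdef
    have hzQ : zQ = -xQ / yQ := by rw [hzQdef, hQc, Affine.Point.zCoord_some]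
    have hz0 : zQ ≠ 0 := fun h ↦ hQ0 ((FormalGroupChart.zCoord_eq_zero_iff hker).mp h)
    have hzlt : w zQ < 1 := FormalGroupChart.val_zCoord_lt_one hker
    have hwz0 : w zQ ≠ 0 := (Valuation.ne_zero_iff w).mpr hz0
    have hzpos : 0 < w zQ := zero_lt_iff.mpr hwz0
    -- linearity of `z` along the line
    have hBQ : ∀ b : ℕ, 1 ≤ b → b < N →
        b • Q ∈ FormalGroupChart.kernel w (W₀.baseChange L) ∧ w (b • Q).zCoord = w zQ ∧
          w ((b • Q).zCoord - (b : L) * zQ) ≤ w zQ ^ 2 := fun b hb1 hbN ↦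
      hB hker hb1 fun b' h1 h2 ↦ hwb b' h1 (lt_of_le_of_lt h2 hbN)
    -- the product over the line: `|z|^{N-1} = |u|^{N-1} |q₀|`
    obtain ⟨q₀, hq₀⟩ := hE X N hPt0 hrt
    change ∏ b ∈ Finset.Ico 1 N, (b • Ps).zCoord = (q₀ : L) at hq₀
    have hprod : ∏ b ∈ Finset.Ico 1 N, (b • Q).zCoord = u ^ (N - 1) * (q₀ : L) := by
      rw [← hq₀, ← Nat.card_Ico 1 N, ← Finset.prod_const, ← Finset.prod_mul_distrib]
      refine Finset.prod_congr rfl fun b _ ↦ ?_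
      rw [hQmul, hΦz]
    have hwprod : w zQ ^ (N - 1) = w u ^ (N - 1) * w (q₀ : L) := by
      have h := congrArg w hprod
      rw [map_prod, map_mul, map_pow] at h
      rw [← h, ← Nat.card_Ico 1 N, ← Finset.prod_const]
      refine Finset.prod_congr rfl fun b hb ↦ ?_
      rw [Finset.mem_Ico] at hb
      exact ((hBQ b hb.1 hb.2).2.1).symm
    have hq₀0 : q₀ ≠ 0 := by
      intro h0
      rw [h0, Rat.cast_zero, map_zero, mul_zero] at hwprod
      exact pow_ne_zero _ hwz0 hwprod
    obtain ⟨m₂, hm₂⟩ := exists_val_ratCast_eq_zpow w hN hint hq₀0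
    -- `|z| = gᴶ`, `J = (N-1) n' + e m₂`
    set J : ℤ := ((N - 1 : ℕ) : ℤ) * n' + (e : ℤ) * m₂ with hJdef
    have hzJ : w zQ = g ^ J := by
      refine (pow_left_inj₀ zero_le zero_le hN1.ne').mp ?_
      rw [hwprod, hm₂, hwu, ← htdef, ← hgt, hJdef]
      simp only [← zpow_natCast, ← zpow_mul, ← zpow_add₀ hg0']
      congr 1
      push_cast
      ring
    -- the crude bound: `J ≤ e`; and `0 < J`
    have hJe : J ≤ (e : ℤ) := by
      have hcb := hC N hN2 hNL (V := W₀.baseChange L) (h := hQxy) hxQ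
        (by rw [← hQc, natCast_zsmul, hQN])
      rw [← hzQ, hzJ, ← htdef, ← hgt] at hcb
      have hcb' : (g ^ (e : ℤ)) ^ (N - 1) ≤ (g ^ J) ^ (N - 1) := by
        rwa [zpow_natCast, ← pow_mul]
      exact (StrictAnti.le_iff_ge hganti).mp (le_of_pow_le_pow_left₀ hN1.ne' zero_le hcb')
    have hJ0 : 0 < J := by
      have h : g ^ J < g ^ (0 : ℤ) := by rw [zpow_zero, ← hzJ]; exact hzlt
      exact (StrictAnti.lt_iff_gt hganti).mp h
    -- the character: `z(τP) = τ z`, `z(aQ) ≡ a z`, `τ z ≡ ζ₀ᴶ z`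
    have hτz : (a • Q).zCoord = τ • zQ := by
      rw [hQmul, hΦz, ← hτPs, zCoord_map_algEquiv, hzQdef, hQdef, hΦz, hτsmul, map_mul,
        ← hτsmul u, hτu]
    have hi : w (τ • zQ - (a : L) * zQ) < w zQ := by
      rw [← hτz]
      calc w ((a • Q).zCoord - (a : L) * zQ) ≤ w zQ ^ 2 := (hBQ a ha1 haN).2.2
        _ < w zQ ^ 1 := pow_lt_pow_right_of_lt_one₀ hzpos hzlt one_lt_two
        _ = w zQ := pow_one _
    set y₀ : L := zQ / ρ' ^ J with hy₀
    have hρJ0 : ρ' ^ J ≠ 0 := zpow_ne_zero _ hρ'0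
    have hzy : zQ = ρ' ^ J * y₀ := by rw [hy₀, mul_div_cancel₀ _ hρJ0]
    have hwρJ : w (ρ' ^ J) = g ^ J := by rw [map_zpow₀]
    have hwy₀ : w y₀ = 1 := by rw [hy₀, map_div₀, hzJ, hwρJ, div_self (zpow_ne_zero _ hg0')]
    have hτρJ : τ • (ρ' ^ J) = ζ₀ ^ J * ρ' ^ J := by
      rw [hτsmul, map_zpow₀, ← hτsmul, hτρ, mul_zpow]
    have hii : w (τ • zQ - ζ₀ ^ J * zQ) < w zQ := by
      have e2 : τ • zQ - ζ₀ ^ J * zQ = ζ₀ ^ J * ρ' ^ J * (τ • y₀ - y₀) := by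
        rw [hzy, smul_mul', hτρJ]; ring
      rw [e2, map_mul, map_mul, map_zpow₀, hwζ₀, one_zpow, one_mul, hwρJ, ← hzJ]
      calc w zQ * w (τ • y₀ - y₀) < w zQ * 1 := by gcongr; exact hinert τ hτI y₀ hwy₀.le
        _ = w zQ := mul_one _
    have hiii : w (ζ₀ ^ J - (a : L)) < 1 := by
      have h3 : w ((ζ₀ ^ J - (a : L)) * zQ) < w zQ := by
        have e3 : (ζ₀ ^ J - (a : L)) * zQ = (τ • zQ - (a : L) * zQ) - (τ • zQ - ζ₀ ^ J * zQ) := by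
          ring
        rw [e3]
        exact Valuation.map_sub_lt w hi hii
      rw [map_mul] at h3
      calc w (ζ₀ ^ J - (a : L)) = w (ζ₀ ^ J - (a : L)) * w zQ / w zQ := by
            rw [mul_div_assoc, div_self hzpos.ne', mul_one]
        _ < w zQ / w zQ := by gcongr
        _ = 1 := div_self hzpos.ne'
    -- so `ζ₀ᴶ ≡ ζ₀^{e k₀}`
    have hiv : w (ζ₀ ^ J - (ζ₀ ^ e) ^ k₀) < 1 := by
      have e4 : ζ₀ ^ J - (ζ₀ ^ e) ^ k₀ =
          (ζ₀ ^ J - (a : L)) + ((a : L) - (c : L) ^ k₀) + -((ζ₀ ^ e) ^ k₀ - (c : L) ^ k₀) := by ring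
      rw [e4]
      refine Valuation.map_add_lt w (Valuation.map_add_lt w hiii hac) ?_
      rwa [Valuation.map_neg]
    set η : L := ζ₀ ^ (J - (e : ℤ) * k₀) with hηdef
    have hηprod : ζ₀ ^ J - (ζ₀ ^ e) ^ k₀ = (ζ₀ ^ e) ^ k₀ * (η - 1) := by
      have e5 : (ζ₀ ^ e) ^ k₀ = ζ₀ ^ ((e : ℤ) * k₀) := by
        rw [← zpow_natCast, ← zpow_natCast, ← zpow_mul]
      rw [e5, hηdef, mul_sub, mul_one, ← zpow_add₀ hζ₀0, add_sub_cancel]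
    have hwek : w ((ζ₀ ^ e) ^ k₀) = 1 := by rw [map_pow, map_pow, hwζ₀, one_pow, one_pow]
    have hη1 : w (η - 1) < 1 := by
      rw [hηprod, map_mul, hwek, one_mul] at hiv
      exact hiv
    have hηN : η ^ (N - 1) = 1 := by
      rw [hηdef, ← zpow_natCast, ← zpow_mul, mul_comm, zpow_mul, zpow_natCast, hζ₀1, one_zpow]
    have hηone : η = 1 := eq_one_of_pow_eq_one_of_val_sub_one_lt w hwM hηN hη1
    have hdvd : ((N - 1 : ℕ) : ℤ) ∣ J - (e : ℤ) * k₀ := (hζ₀.zpow_eq_one_iff_dvd _).mp hηone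
    -- conclusion
    refine ⟨e, he, J.toNat, ?_, ?_⟩
    · have : (J.toNat : ℤ) ≤ e := by rw [Int.toNat_of_nonneg hJ0.le]; exact hJe
      exact_mod_cast this
    · rw [Nat.modEq_iff_dvd]
      push_cast
      rw [Int.toNat_of_nonneg hJ0.le]
      have e6 : (J.toNat : ℤ) - (e : ℤ) * (k₀ : ℤ) = J - (e : ℤ) * k₀ := by
        rw [Int.toNat_of_nonneg hJ0.le]
      simpa using hdvd
  · -- ÉTALE CASE: the line misses the kernel of reduction, so `r(τ) = 1` and `j = 0`
    set red := goodReductionHom W₀ hv0 hΔ0 with hred_def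
    have hredQ : red Q ≠ 0 := by
      intro h0
      rcases hQc : Q with _ | ⟨xQ, yQ, hQxy⟩
      · exact hQ0 hQc
      · rw [hQc, hred_def, goodReductionHom_eq_zero_iff hv0 hΔ0,
          WeierstrassCurve.reducesToZero_some_iff hQxy, not_mem_range_iff hv0] at h0
        rw [hQc] at hker
        exact hker (FormalGroupChart.some_mem_kernel hQxy h0)
    have hordQ : addOrderOf (red Q) = N :=
      addOrderOf_eq_prime (by rw [← map_nsmul, hQN, map_zero]) hredQ
    have ha : a = 1 := by
      have h1 : (a - 1) • red Q = 0 := by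
        have h2 : a • red Q = red Q := by rw [← map_nsmul]; exact hred
        conv_lhs at h2 => rw [← Nat.sub_add_cancel ha1, succ_nsmul]
        exact add_eq_right.mp h2 |> fun h ↦ by
          have := h2
          rw [add_comm] at this
          exact (add_eq_left.mp this)
      have hdvd : N ∣ a - 1 := by
        rw [← hordQ]; exact addOrderOf_dvd_iff_nsmul_eq_zero.mpr h1
      have : a - 1 = 0 := Nat.eq_zero_of_dvd_of_lt hdvd (by omega)
      omega
    rw [ha, Nat.cast_one] at hac
    -- `ζ₀^{e k₀} ≡ c^{k₀} ≡ 1`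
    have hη : w ((ζ₀ ^ e) ^ k₀ - 1) < 1 := by
      have e1 : (ζ₀ ^ e) ^ k₀ - 1 = ((ζ₀ ^ e) ^ k₀ - (c : L) ^ k₀) + -(1 - (c : L) ^ k₀) := by ring
      rw [e1]
      exact Valuation.map_add_lt w hζeck (by rwa [Valuation.map_neg])
    have hone : (ζ₀ ^ e) ^ k₀ = 1 :=
      eq_one_of_pow_eq_one_of_val_sub_one_lt w hwM
        (by rw [show ((ζ₀ ^ e) ^ k₀) ^ (N - 1) = (ζ₀ ^ (N - 1)) ^ (e * k₀) by ring, hζ₀1, one_pow])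
        hη
    rw [← pow_mul] at hone
    have hdvd : (N - 1) ∣ e * k₀ := (hζ₀.pow_eq_one_iff_dvd _).mp hone
    exact ⟨e, he, 0, Nat.zero_le _, Nat.modEq_zero_iff_dvd.mpr hdvd⟩

end Summit.ABC.ABC.Theorems

end
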